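import Summits.KontsevichZagierPeriods.KontsevichZagierPeriods.Theses.ExponentCosets

/-!
# `CosetDevissage` (stmt-KontsevichZagierPeriods-12833, route ExponentCosets) — birth skeleton

Crux (rank 2, verbatim the route decl `…Theses.ExponentCosets.CosetDevissage`): for every
`ℤ`-combination `c` of box-Mellin members (`[ (0,1)^m ∩ {g_k > 0}, κ·∏ g_k^{e_k} ]`) with
`KZ.eval c = 0` there are `N ≠ 0` and finitely many SINGLE-FIBRE combinations `cs_j` (all members of
`cs_j` in one exponent coset `e₀ + ℤ^K` of one family `g`, each `cs_j` of value `0`) with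
`N • c − Σ_j cs_j ∈ KZ.relations`.

## The line "birth" = SIGN-FIBRE PRESENTATION (N = 1, J = 1), typed over existing declarations

The member class of the crux allows a DISCONNECTED basic domain `(0,1)^n ∩ {g > 0}` and a coset
exponent `−1/2` on a squared separator `q = (x₀ − 1/2)²`; the two members
`(κ/2)·q^{−1/2}` and `−κ·x₀·q^{−1/2}` of ONE coset of ONE family sum to the step `κ·sign(1/2 − x₀)`.
Hence every difference of two volumes is congruent, by PROVED moves only (rules 1a, 1b, 2, 3 —
no period theory), to ONE single-fibre combination, and the crux follows with `N = 1`, `J = 1`,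
the value-`0` side condition coming from soundness `KZ.relations_le_ker_eval_holds`.
Three stubs, each a genuine lemma of the line:

* `stub_volumePair` (NORMAL FORM, size S/M): every formal combination `c` is, modulo
  `KZ.relations`, a difference `[A] − [B]` of two BOUNDED volume representations (integrand `1`)
  of ONE dimension. Plan: `KZ.exists_integralRep_sub_holds` (`c ≡ [r] − [r′]`), Viu-Sos'
  semi-canonical reduction `KZ.IntegralRep.exists_sub_volumeRep_mem_relations_of_semiCanonicalReduction
  KZ.semiCanonicalReduction_holds` (each `[r] ≡ [A] − [B]`, compact volumes), common dimension by
  unit slabs `KZ.IntegralRep.exists_volumeRep_equivalent_of_le`, merging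
  `KZ.IntegralRep.exists_volumeRep_of_add_sub_of_mem_relations`.
* `stub_basicPlacement` (FAR GENERIC PLACEMENT, the hardest stub, size L): two bounded volumes
  `A`, `B ⊂ ℝ^d` are carried, modulo relations, by the two halves `x₀ < 1/2`, `x₀ > 1/2` of ONE
  basic open set `D = (0,1)^{n+1} ∩ {G_k > 0}` kept away from the separator (`(x₀ − 1/2)² > 1/16`
  on `D`), with a common constant integrand `κ ∈ ℚ`: `[A] ≡ [D ∩ {x₀ < 1/2}, κ]`,
  `[B] ≡ [D ∩ {x₀ > 1/2}, κ]`. Plan: a.e. sign-cell decomposition of `A`, `B` w.r.t. their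
  describing polynomials (rule 1a; null sets are relations, Tarski–Seidenberg
  `Literature.ModelTheory.ExponentialFields.tarski_seidenberg_real_holds`), translation of each cell
  far out in a generic direction (rule 2, Jacobian 1) so that every OTHER cell's describing
  polynomials have constant sign on it, the exactifying trick `p ↦ p·(p + C)` to make the disjoint
  union of the moved cells basic EXACTLY, the interval-union selector in `x₀`, one common
  dilation into the unit box (rule 2, constant Jacobian `κ⁻¹ ∈ ℚ`) and unit slabs (rule 3) to
  equalise dimensions.
* `stub_signRows` (THE TWO MEMBERS, size M): for such data, `[D ∩ {x₀ < 1/2}, κ] − [D ∩ {x₀ > 1/2}, κ]`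
  is congruent to a two-member single-fibre combination in the crux's own fibre predicate:
  family `(G, (X₀ − 1/2)² − 1/16, (X₀ − 1/2)², X₀)` (same domain `D`), coset
  `e₀ = (0,…,0, 0, −1/2, 0)`, members `(κ/2)·q^{−1/2}` (`ν = 0`) and `−κ·X₀·q^{−1/2}`
  (`ν = (0,…,0,0,0,1)`), `a = (1, 1)`; rules 1b (sum of integrands = `κ·sign(1/2 − x₀)` on `D`) and
  1a (split `D` at the empty slice `x₀ = 1/2`); both members are bounded (`q > 1/16` on `D`),
  `ℚ`-semialgebraic, hence genuine `KZ.IntegralRep`s.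

Composition (sorry-free core `fibreWitness_of_stubs`): `c ≡ [A] − [B] ≡ [P] − [M] ≡ s` in the free
abelian group, `KZ.eval s = KZ.eval c = 0` by `KZ.relations_le_ker_eval_holds`, witnesses `N = 1`,
`J = 1`, `cs = fun _ => s`. `CosetDevissage_of : CosetDevissage` consumes the three stubs BY NAME
(first theorem concluding the crux, as the mechanical audit `#h21_check_skeleton` requires; its only
`sorryAx` dependencies are the three `stub_*`), and `CosetDevissage_of_stubs :
stub₁-sig → stub₂-sig → stub₃-sig → CosetDevissage` is the arrows form (no `sorryAx` at all).

NOTE FOR THE PLANNER OF RECORD / LEAD. This is the line found by the refuters of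
stmt-KontsevichZagierPeriods-12834/12833 (evidence EVIDENCE.md §3–4 "Theorem A", SignFibre.lean
`sign_fibre`, Skeleton.lean `cosetDevissage_of_singleFibreAccessibility`, 2026-08-15): it closes the
crux AS TYPED with `N = 1`, `J = 1` and no period input — the dévissage never meets Gauss
multiplication or Chowla–Selberg. Under the refuters' repaired member class (`0 < g_k` on the whole
open box, domain `= (0,1)^m`, Repair.lean `CosetKernelRepaired`) `stub_signRows` has no analogue
(members become real-analytic on a connected domain and cannot sum to a step) and this line dies;
the route is in the re-audit bin REPAIRABLE. The registrar does not restate the crux (fixed decl).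
Disproof used: none on file (`ledger crux ls` shows no `Disproof.lean`, no dead lines; `ledger
negatives --problem KontsevichZagierPeriods` has no entry bearing on volume pairs or sign fibres).
-/

set_option linter.dupNamespace false

namespace Summit.KontsevichZagierPeriods.KontsevichZagierPeriods.Cruxes.CosetDevissage.Birth

open Summit.KontsevichZagierPeriods.KontsevichZagierPeriods.Theses.ExponentCosets (CosetDevissage)

open Literature.NumberTheory.Transcendental

/-- Stub 1 (NORMAL FORM — bounded volume pair of one dimension): every formal `ℤ`-combination of
integral representations is congruent modulo `KZ.relations` to `[A] − [B]` with `A`, `B` two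
representations of ONE dimension with bounded domains and integrand `1` on them. Why plausibly
true: it is Viu-Sos' semi-canonical reduction (tree: `KZ.semiCanonicalReduction_holds`,
`KZ.IntegralRep.exists_sub_volumeRep_mem_relations_of_semiCanonicalReduction`) applied to the two
ends of `KZ.exists_integralRep_sub_holds`, followed by the dimension-raising and merging lemmas
`KZ.IntegralRep.exists_volumeRep_equivalent_of_le`, `…exists_volumeRep_of_add_sub_of_mem_relations`.
Why it might fail: only bookkeeping risk (four compact volumes of two dimensions to be merged into
two of one dimension). Size S/M. [cite: ViuSos2021, Thm. 1.1] [cite: CressonViusos2022, §1 p. 326] -/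
theorem stub_volumePair :
    ∀ c : KZ.FormalRep, ∃ (d : ℕ) (A B : KZ.IntegralRep d),
      Bornology.IsBounded A.domain ∧ Bornology.IsBounded B.domain ∧
      (∀ x ∈ A.domain, A.integrand x = 1) ∧ (∀ x ∈ B.domain, B.integrand x = 1) ∧
      c - (KZ.of A - KZ.of B) ∈ KZ.relations := by
  sorry

/-- Stub 2 (FAR GENERIC PLACEMENT — the hardest stub): two bounded volume representations `A`, `B`
of one dimension `d` are carried, modulo `KZ.relations`, by the two halves of ONE basic open subset
`D = (0,1)^{n+1} ∩ {G_k > 0}` of a unit box, `D` staying away from the separating hyperplane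
(`(x₀ − 1/2)² > 1/16` on `D`), with one common constant integrand `κ ∈ ℚ`:
`[A] − [D ∩ {x₀ < 1/2}, κ] ∈ relations` and `[B] − [D ∩ {x₀ > 1/2}, κ] ∈ relations`.
Why plausibly true: off the null set of zeros of its describing polynomials a semialgebraic set is
the disjoint union of open SIGN CELLS (basic); translating each cell far out in a generic direction
makes every other cell's describing polynomials of constant sign on it, and `p ↦ p·(p + C)`
(`C` larger than `sup |p|` on its own cell) turns "positive here, anything of constant sign there"
into "positive here AND there", so the disjoint union of the moved cells is basic EXACTLY; an
interval-union selector `−∏(x₀ − a_α)(x₀ − b_α)` and box selectors bound the regions; one rational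
dilation into the unit box (rule 2, Jacobian `κ⁻¹`) and unit slabs (rule 3) finish. Moves used:
1a, 2, 3 only. Why it might fail: the exact (not a.e.) basicness of the union after placement in
the presence of cells of `A` that are not full-dimensional-regular (cusps reaching the region
boundary) — the a.e. freedom is only on the `A` side, the member domain is literal. Size L.
[cite: KontsevichZagier2001, §1.2 rules (1),(2),(3)] [cite: ViuSos2021, Cor. 2.3] -/
theorem stub_basicPlacement :
    ∀ (d : ℕ) (A B : KZ.IntegralRep d),
      Bornology.IsBounded A.domain → Bornology.IsBounded B.domain →
      (∀ x ∈ A.domain, A.integrand x = 1) → (∀ x ∈ B.domain, B.integrand x = 1) →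
      ∃ (n K : ℕ) (G : Fin K → MvPolynomial (Fin (n + 1)) ℚ) (κ : ℚ)
        (P M : KZ.IntegralRep (n + 1)),
        (∀ x : Fin (n + 1) → ℝ, (∀ j, x j ∈ Set.Ioo (0:ℝ) 1) →
          (∀ k, 0 < MvPolynomial.aeval x (G k)) → (1:ℝ) / 16 < (x 0 - 1 / 2) ^ 2) ∧
        P.domain = {x | ((∀ j, x j ∈ Set.Ioo (0:ℝ) 1) ∧ ∀ k, 0 < MvPolynomial.aeval x (G k)) ∧
          x 0 < 1 / 2} ∧
        M.domain = {x | ((∀ j, x j ∈ Set.Ioo (0:ℝ) 1) ∧ ∀ k, 0 < MvPolynomial.aeval x (G k)) ∧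
          1 / 2 < x 0} ∧
        Set.EqOn P.integrand (fun _ => (κ : ℝ)) P.domain ∧
        Set.EqOn M.integrand (fun _ => (κ : ℝ)) M.domain ∧
        KZ.of A - KZ.of P ∈ KZ.relations ∧ KZ.of B - KZ.of M ∈ KZ.relations := by
  sorry

/-- Stub 3 (THE SIGN ROWS — two members of one coset of one family): for a basic open
`D = (0,1)^{n+1} ∩ {G_k > 0}` with `(x₀ − 1/2)² > 1/16` on `D` and the two halves
`P = [D ∩ {x₀ < 1/2}, κ]`, `M = [D ∩ {x₀ > 1/2}, κ]`, the difference `[P] − [M]` is congruent modulo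
`KZ.relations` to a single-fibre combination `Σ a_i [r_i]` in the crux's own fibre predicate.
Witness: family `g = (G, (X₀ − 1/2)² − 1/16, (X₀ − 1/2)², X₀)` (its domain is `D` again), coset
`e₀ = (0,…,0, 0, −1/2, 0)`, `L = 2`, `κ' = (κ/2, −κ)`, `ν₁ = 0`, `ν₂ = (0,…,0,0,0,1)`, `a = (1,1)`:
the integrands `(κ/2)·|x₀ − 1/2|⁻¹` and `−κ·x₀·|x₀ − 1/2|⁻¹` are bounded by `4|κ|` on `D`,
`ℚ`-semialgebraic, and sum to `κ·sign(1/2 − x₀)`; then rule 1b (`[r₁] + [r₂] ≡ [D, κ·sign]`),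
rule 1a at the empty slice `x₀ = 1/2` and rule 1b again (`[S, −κ] + [S, κ] ≡ 0`). Why it might fail:
only the `IsSemialgebraicFunOn` / `IntegrableOn` side conditions of the two members in the exact
`Real.rpow` shape of the predicate (`((x₀ − 1/2)²) ^ (−1/2 : ℝ)`). Size M.
[cite: KontsevichZagier2001, §1.2 rules (1a),(1b)] -/
theorem stub_signRows :
    ∀ (n K : ℕ) (G : Fin K → MvPolynomial (Fin (n + 1)) ℚ) (κ : ℚ) (P M : KZ.IntegralRep (n + 1)),
      (∀ x : Fin (n + 1) → ℝ, (∀ j, x j ∈ Set.Ioo (0:ℝ) 1) →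
        (∀ k, 0 < MvPolynomial.aeval x (G k)) → (1:ℝ) / 16 < (x 0 - 1 / 2) ^ 2) →
      P.domain = {x | ((∀ j, x j ∈ Set.Ioo (0:ℝ) 1) ∧ ∀ k, 0 < MvPolynomial.aeval x (G k)) ∧
        x 0 < 1 / 2} →
      M.domain = {x | ((∀ j, x j ∈ Set.Ioo (0:ℝ) 1) ∧ ∀ k, 0 < MvPolynomial.aeval x (G k)) ∧
        1 / 2 < x 0} →
      Set.EqOn P.integrand (fun _ => (κ : ℝ)) P.domain →
      Set.EqOn M.integrand (fun _ => (κ : ℝ)) M.domain →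
      ∃ (m K' L : ℕ) (g : Fin K' → MvPolynomial (Fin m) ℚ) (e₀ : Fin K' → ℚ) (ν : Fin L → Fin K' → ℤ)
        (κ' : Fin L → ℚ) (a : Fin L → ℤ) (r : Fin L → KZ.IntegralRep m),
        (∀ i, (r i).domain = {x | (∀ j, x j ∈ Set.Ioo (0:ℝ) 1) ∧ ∀ k, 0 < MvPolynomial.aeval x (g k)} ∧
          Set.EqOn (r i).integrand
            (fun x => (κ' i : ℝ) * ∏ k, (MvPolynomial.aeval x (g k)) ^ ((e₀ k + (ν i k : ℚ) : ℚ) : ℝ))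
            (r i).domain) ∧
        (KZ.of P - KZ.of M) - ∑ i, a i • KZ.of (r i) ∈ KZ.relations := by
  sorry

/-! ### Composition (no `sorry` below this line) -/

/-- **Composition core** (sorry-free; its conclusion is the BODY of the crux at a given `c`, so that
the mechanical skeleton audit, which takes the first theorem concluding the crux by name, sees
`CosetDevissage_of` below): normal form, placement, sign rows, chained in the free abelian group
`KZ.FormalRep` (`c − s = (c − ([A] − [B])) + ([A] − [P]) − ([B] − [M]) + (([P] − [M]) − s)`), then
soundness of the moves (`KZ.relations_le_ker_eval_holds`) transfers `KZ.eval c = 0` to the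
single-fibre combination `s`; witnesses `N = 1`, `J = 1`, `cs = fun _ => s`. The Mellin-span
membership of `c` is not needed (the normal form holds for every formal combination).
[cite: KontsevichZagier2001, §1.2] -/
theorem fibreWitness_of_stubs
    (hPair :
    (∀ c : KZ.FormalRep, ∃ (d : ℕ) (A B : KZ.IntegralRep d),
      Bornology.IsBounded A.domain ∧ Bornology.IsBounded B.domain ∧
      (∀ x ∈ A.domain, A.integrand x = 1) ∧ (∀ x ∈ B.domain, B.integrand x = 1) ∧
      c - (KZ.of A - KZ.of B) ∈ KZ.relations))
    (hPlace :
    (∀ (d : ℕ) (A B : KZ.IntegralRep d),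
      Bornology.IsBounded A.domain → Bornology.IsBounded B.domain →
      (∀ x ∈ A.domain, A.integrand x = 1) → (∀ x ∈ B.domain, B.integrand x = 1) →
      ∃ (n K : ℕ) (G : Fin K → MvPolynomial (Fin (n + 1)) ℚ) (κ : ℚ)
        (P M : KZ.IntegralRep (n + 1)),
        (∀ x : Fin (n + 1) → ℝ, (∀ j, x j ∈ Set.Ioo (0:ℝ) 1) →
          (∀ k, 0 < MvPolynomial.aeval x (G k)) → (1:ℝ) / 16 < (x 0 - 1 / 2) ^ 2) ∧
        P.domain = {x | ((∀ j, x j ∈ Set.Ioo (0:ℝ) 1) ∧ ∀ k, 0 < MvPolynomial.aeval x (G k)) ∧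
          x 0 < 1 / 2} ∧
        M.domain = {x | ((∀ j, x j ∈ Set.Ioo (0:ℝ) 1) ∧ ∀ k, 0 < MvPolynomial.aeval x (G k)) ∧
          1 / 2 < x 0} ∧
        Set.EqOn P.integrand (fun _ => (κ : ℝ)) P.domain ∧
        Set.EqOn M.integrand (fun _ => (κ : ℝ)) M.domain ∧
        KZ.of A - KZ.of P ∈ KZ.relations ∧ KZ.of B - KZ.of M ∈ KZ.relations))
    (hRows :
    (∀ (n K : ℕ) (G : Fin K → MvPolynomial (Fin (n + 1)) ℚ) (κ : ℚ) (P M : KZ.IntegralRep (n + 1)),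
      (∀ x : Fin (n + 1) → ℝ, (∀ j, x j ∈ Set.Ioo (0:ℝ) 1) →
        (∀ k, 0 < MvPolynomial.aeval x (G k)) → (1:ℝ) / 16 < (x 0 - 1 / 2) ^ 2) →
      P.domain = {x | ((∀ j, x j ∈ Set.Ioo (0:ℝ) 1) ∧ ∀ k, 0 < MvPolynomial.aeval x (G k)) ∧
        x 0 < 1 / 2} →
      M.domain = {x | ((∀ j, x j ∈ Set.Ioo (0:ℝ) 1) ∧ ∀ k, 0 < MvPolynomial.aeval x (G k)) ∧
        1 / 2 < x 0} →
      Set.EqOn P.integrand (fun _ => (κ : ℝ)) P.domain →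
      Set.EqOn M.integrand (fun _ => (κ : ℝ)) M.domain →
      ∃ (m K' L : ℕ) (g : Fin K' → MvPolynomial (Fin m) ℚ) (e₀ : Fin K' → ℚ) (ν : Fin L → Fin K' → ℤ)
        (κ' : Fin L → ℚ) (a : Fin L → ℤ) (r : Fin L → KZ.IntegralRep m),
        (∀ i, (r i).domain = {x | (∀ j, x j ∈ Set.Ioo (0:ℝ) 1) ∧ ∀ k, 0 < MvPolynomial.aeval x (g k)} ∧
          Set.EqOn (r i).integrand
            (fun x => (κ' i : ℝ) * ∏ k, (MvPolynomial.aeval x (g k)) ^ ((e₀ k + (ν i k : ℚ) : ℚ) : ℝ))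
            (r i).domain) ∧
        (KZ.of P - KZ.of M) - ∑ i, a i • KZ.of (r i) ∈ KZ.relations))
    (c : KZ.FormalRep) (hc0 : KZ.eval c = 0) :
    ∃ N : ℕ, N ≠ 0 ∧ ∃ (J : ℕ) (cs : Fin J → KZ.FormalRep),
      (∀ j, ∃ (m K L : ℕ) (g : Fin K → MvPolynomial (Fin m) ℚ) (e₀ : Fin K → ℚ) (ν : Fin L → Fin K → ℤ)
        (κ : Fin L → ℚ) (a : Fin L → ℤ) (r : Fin L → KZ.IntegralRep m),
        (∀ i, (r i).domain = {x | (∀ j, x j ∈ Set.Ioo (0:ℝ) 1) ∧ ∀ k, 0 < MvPolynomial.aeval x (g k)} ∧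
          Set.EqOn (r i).integrand
            (fun x => (κ i : ℝ) * ∏ k, (MvPolynomial.aeval x (g k)) ^ ((e₀ k + (ν i k : ℚ) : ℚ) : ℝ))
            (r i).domain) ∧
        KZ.eval (∑ i, a i • KZ.of (r i)) = 0 ∧ cs j = ∑ i, a i • KZ.of (r i)) ∧
      N • c - ∑ j, cs j ∈ KZ.relations := by
  obtain ⟨d, A, B, hAb, hBb, hA1, hB1, hcAB⟩ := hPair c
  obtain ⟨n, K, G, κ, P, M, hq, hPd, hMd, hPi, hMi, hAP, hBM⟩ := hPlace d A B hAb hBb hA1 hB1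
  obtain ⟨m, K', L, g, e₀, ν, κ', a, r, hr, hs⟩ := hRows n K G κ P M hq hPd hMd hPi hMi
  set s : KZ.FormalRep := ∑ i, a i • KZ.of (r i) with hs_def
  -- `c ≡ s` modulo relations
  have hcs : c - s ∈ KZ.relations := by
    have key : c - s = (c - (KZ.of A - KZ.of B)) + (KZ.of A - KZ.of P) - (KZ.of B - KZ.of M) +
        ((KZ.of P - KZ.of M) - s) := by
      abel
    rw [key]
    exact KZ.relations.add_mem (KZ.relations.sub_mem (KZ.relations.add_mem hcAB hAP) hBM) hs
  -- soundness of the moves: `eval s = eval c = 0`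
  have hs0 : KZ.eval s = 0 := by
    have h := KZ.relations_le_ker_eval_holds hcs
    rw [AddMonoidHom.mem_ker, map_sub, hc0, zero_sub, neg_eq_zero] at h
    exact h
  refine ⟨1, one_ne_zero, 1, fun _ => s, fun _ => ⟨m, K', L, g, e₀, ν, κ', a, r, hr, hs0, rfl⟩, ?_⟩
  simpa [one_nsmul, Fin.sum_univ_one] using hcs

/-- **The skeleton theorem** — the crux `…Theses.ExponentCosets.CosetDevissage` BY NAME from the three
registered stubs consumed BY NAME (`stub_volumePair`, `stub_basicPlacement`, `stub_signRows`): the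
mechanical audit `#h21_check_skeleton` admits no inline `Prop` hypotheses on the first theorem that
concludes the crux, so this by-name form comes first; the arrows form demanded by the registrar
brief, `stub₁-sig → stub₂-sig → stub₃-sig → CosetDevissage`, is `CosetDevissage_of_stubs` right
below, over the same sorry-free core `fibreWitness_of_stubs`. `#print axioms` = whitelist ∪
`sorryAx` via the three stubs only. [cite: KontsevichZagier2001, §1.2] -/
theorem CosetDevissage_of : CosetDevissage := by
  intro c _hc hc0
  exact fibreWitness_of_stubs stub_volumePair stub_basicPlacement stub_signRows c hc0

/-- **Composition, arrows form** (sorry-free, axioms `propext`·`Classical.choice`·`Quot.sound` only):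
`stub_volumePair-sig → stub_basicPlacement-sig → stub_signRows-sig → CosetDevissage`, the crux by
name. [cite: KontsevichZagier2001, §1.2] -/
theorem CosetDevissage_of_stubs :
    (∀ c : KZ.FormalRep, ∃ (d : ℕ) (A B : KZ.IntegralRep d),
      Bornology.IsBounded A.domain ∧ Bornology.IsBounded B.domain ∧
      (∀ x ∈ A.domain, A.integrand x = 1) ∧ (∀ x ∈ B.domain, B.integrand x = 1) ∧
      c - (KZ.of A - KZ.of B) ∈ KZ.relations) →
    (∀ (d : ℕ) (A B : KZ.IntegralRep d),
      Bornology.IsBounded A.domain → Bornology.IsBounded B.domain →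
      (∀ x ∈ A.domain, A.integrand x = 1) → (∀ x ∈ B.domain, B.integrand x = 1) →
      ∃ (n K : ℕ) (G : Fin K → MvPolynomial (Fin (n + 1)) ℚ) (κ : ℚ)
        (P M : KZ.IntegralRep (n + 1)),
        (∀ x : Fin (n + 1) → ℝ, (∀ j, x j ∈ Set.Ioo (0:ℝ) 1) →
          (∀ k, 0 < MvPolynomial.aeval x (G k)) → (1:ℝ) / 16 < (x 0 - 1 / 2) ^ 2) ∧
        P.domain = {x | ((∀ j, x j ∈ Set.Ioo (0:ℝ) 1) ∧ ∀ k, 0 < MvPolynomial.aeval x (G k)) ∧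
          x 0 < 1 / 2} ∧
        M.domain = {x | ((∀ j, x j ∈ Set.Ioo (0:ℝ) 1) ∧ ∀ k, 0 < MvPolynomial.aeval x (G k)) ∧
          1 / 2 < x 0} ∧
        Set.EqOn P.integrand (fun _ => (κ : ℝ)) P.domain ∧
        Set.EqOn M.integrand (fun _ => (κ : ℝ)) M.domain ∧
        KZ.of A - KZ.of P ∈ KZ.relations ∧ KZ.of B - KZ.of M ∈ KZ.relations) →
    (∀ (n K : ℕ) (G : Fin K → MvPolynomial (Fin (n + 1)) ℚ) (κ : ℚ) (P M : KZ.IntegralRep (n + 1)),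
      (∀ x : Fin (n + 1) → ℝ, (∀ j, x j ∈ Set.Ioo (0:ℝ) 1) →
        (∀ k, 0 < MvPolynomial.aeval x (G k)) → (1:ℝ) / 16 < (x 0 - 1 / 2) ^ 2) →
      P.domain = {x | ((∀ j, x j ∈ Set.Ioo (0:ℝ) 1) ∧ ∀ k, 0 < MvPolynomial.aeval x (G k)) ∧
        x 0 < 1 / 2} →
      M.domain = {x | ((∀ j, x j ∈ Set.Ioo (0:ℝ) 1) ∧ ∀ k, 0 < MvPolynomial.aeval x (G k)) ∧
        1 / 2 < x 0} →
      Set.EqOn P.integrand (fun _ => (κ : ℝ)) P.domain →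
      Set.EqOn M.integrand (fun _ => (κ : ℝ)) M.domain →
      ∃ (m K' L : ℕ) (g : Fin K' → MvPolynomial (Fin m) ℚ) (e₀ : Fin K' → ℚ) (ν : Fin L → Fin K' → ℤ)
        (κ' : Fin L → ℚ) (a : Fin L → ℤ) (r : Fin L → KZ.IntegralRep m),
        (∀ i, (r i).domain = {x | (∀ j, x j ∈ Set.Ioo (0:ℝ) 1) ∧ ∀ k, 0 < MvPolynomial.aeval x (g k)} ∧
          Set.EqOn (r i).integrand
            (fun x => (κ' i : ℝ) * ∏ k, (MvPolynomial.aeval x (g k)) ^ ((e₀ k + (ν i k : ℚ) : ℚ) : ℝ))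
            (r i).domain) ∧
        (KZ.of P - KZ.of M) - ∑ i, a i • KZ.of (r i) ∈ KZ.relations) →
    CosetDevissage := by
  intro hPair hPlace hRows c _hc hc0
  exact fibreWitness_of_stubs hPair hPlace hRows c hc0

end Summit.KontsevichZagierPeriods.KontsevichZagierPeriods.Cruxes.CosetDevissage.Birth
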